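import Summits.ResolutionOfSingularities.ResolutionOfSingularities.Theorems.MarkedTransferCampaignW46MohWindowShadeFormalNRStepCore
import Summits.ResolutionOfSingularities.ResolutionOfSingularities.Theorems.MarkedTransferCampaignW46MohWindowShadeFormalNRStalkChart
import Summits.ResolutionOfSingularities.ResolutionOfSingularities.Theorems.MarkedTransferCampaignW46MohWindowShadeFormalNRReindex
import Summits.ResolutionOfSingularities.ResolutionOfSingularities.Theorems.MarkedTransferCampaignW46MohWindowShadeFormalNRStepPrep
import Summits.ResolutionOfSingularities.ResolutionOfSingularities.Theorems.MarkedTransferCampaignW46MohWindowShadePSBaseChange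
import Summits.ResolutionOfSingularities.ResolutionOfSingularities.Theorems.MarkedTransferCampaignW46MohWindowShadeFormalInsepStep
import HarnessLib

/-!
# [OURS · L1 W4.6 rung (iii-2), NON-RATIONAL POINTS, brick 7] THE FORMAL STEP AT AN ARBITRARY CLOSED POINT (scheme level): the anchor
# upstairs lives over the residue field of the point; its model series, read in an algebraic closure `Ω`, is the series step of the model
# series downstairs read in `Ω`

Cell `res-hironaka`, LADDER-RESOLUTION rung L (D-0089), slot W4.6 rung (iii); seat res-L1-s46-pv-6 (gen 7). Host route MarkedTransfer,
`--supports stmt-ResolutionOfSingularities-16155 --as helper`; kind proof (no definition). NON-RATIONAL twin of gen 6's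
`exists_formalInsepAnchor_step` (p548479): NO residual-rationality hypothesis `hrat`, the coefficient field `K₀` of the anchor is ANY perfect
field of characteristic `p` (not the ground field), and the new anchor has a NEW coefficient field `K₁ = K₀(λ)` (the residue field of the
point), embedded `ι₁ : K₁ → Ω` into a fixed field `Ω` containing `K₀` (`ιΩ`) and a root of every polynomial (algebraically closed), with
`ι₁ ∘ (K₀ → K₁) = ιΩ`; the MODEL bookkeeping is done in `Ω⟦y⟧`: the new model series `F′ ∈ K₁⟦y⟧` satisfies
`F′ ⊗ Ω = ((F ⊗ Ω, r).step p c b).F` at the `Ω`-point `b = (c ↦ 0, c′ ↦ λ)` of the Hauser–Wagner frame (translated points in the chart `u₀`,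
the chart `u₁` only at its origin — a torus point delivered in the chart `u₁` is RE-READ in the chart `u₀`, brick 5), an EQUIMULTIPLE point
of `(F ⊗ Ω, r)`; and `λ` is a root of `π^{ιΩ}`, `π ∈ K₀[X]` irreducible monic, every element of `K₁` a `K₀`-polynomial in `λ` (so `K₁` embeds
onto `ιΩ(K₀)[λ]`). Assembly: adapted r.s.p. (pv-2 brick 13), NON-RATIONAL chart data of the Rees-chart stalk (brick 4, maximality from
`dim 𝒪_{Z′,ξ′} = 3`), `z/uᵢ ∈ 𝔪` and exclusion of the `z`-chart origin (brick 6), chart change at torus points (brick 5), the ring-level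
non-rational step (brick 2), base change of the model to `Ω` (`…PSBaseChange`). OURS; NOT a statement of H. Hironaka's manuscript
[claim: Hironaka2017, status: under-review] (Def. 2.1 p.5 «the transform `E′`» — scope only), nothing of which is used; no FACT-LIST premise.
AI-written; AI review is weaker than expert review. References: The Stacks Project, Tag 0804; H. Matsumura (1986) Thm. 8.11, 28.3.
[StacksProject] [Matsumura1987] [folklore]
-/

noncomputable section

set_option linter.dupNamespace false -- mandated namespace of this single-conjunct summit

open IsLocalRing MvPolynomial

namespace Summit.ResolutionOfSingularities.ResolutionOfSingularities.Theorems

namespace CampaignW46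

namespace MohWindowShadeFormalNR

open Literature.AlgebraicGeometry.Resolution
open Literature.AlgebraicGeometry.Resolution.PointBlowup
open Literature.AlgebraicGeometry.Resolution.Hauser2010
open MohWindowShadePS
open CampaignW46.FormalChart
open CampaignW46.ChartPoint
open MohWindowShadeFormalStep (exists_other_index)
open Literature.RingTheory.MvPowerSeries.Jets (mem_maximalIdeal_iff_constantCoeff_eq_zero)

/-! ## §1 Reading the new model series in `Ω` -/

section Omega

variable {p : ℕ} [hp : Fact p.Prime] {K₀ : Type} [Field K₀] [CharP K₀ p] [PerfectRing K₀ p]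
  {Ω : Type} [Field Ω] [IsAlgClosed Ω] [DecidableEq Ω] (ιΩ : K₀ →+* Ω)

omit hp [CharP K₀ p] [PerfectRing K₀ p] in
/-- **The grown coefficient field embeds into `Ω` over `K₀`, and the model step over it is read in `Ω⟦y⟧`** as the step of the base-changed
model at the image point. [folklore] -/
theorem exists_embedding_step (π : Polynomial K₀) [hπ : Fact (Irreducible π)] (i₀ : Fin 2) (F₀ : MvPowerSeries (Fin 2) K₀) (r : Fin 2 →₀ ℕ)
    (hequi : (⟨MvPowerSeries.map (AdjoinRoot.of π) F₀, r⟩ : Series (Fin 2) (AdjoinRoot π)).IsEquimultiplePoint p i₀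
      (fun l : Fin 2 => if l = i₀ then (0 : AdjoinRoot π) else AdjoinRoot.root π)) :
    ∃ (ι₁ : AdjoinRoot π →+* Ω) (b : Fin 2 → Ω), (∀ l, ι₁ (AdjoinRoot.of π l) = ιΩ l) ∧ b i₀ = 0 ∧
      (∀ l, l ≠ i₀ → b l = ι₁ (AdjoinRoot.root π)) ∧ (∀ l, l ≠ i₀ → (π.map ιΩ).eval (b l) = 0) ∧
      (∀ x : AdjoinRoot π, ∃ P : Polynomial K₀, ι₁ x = (P.map ιΩ).eval (ι₁ (AdjoinRoot.root π))) ∧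
      (⟨MvPowerSeries.map ιΩ F₀, r⟩ : Series (Fin 2) Ω).IsEquimultiplePoint p i₀ b ∧
      MvPowerSeries.map ι₁ ((⟨MvPowerSeries.map (AdjoinRoot.of π) F₀, r⟩ : Series (Fin 2) (AdjoinRoot π)).step p i₀
        (fun l : Fin 2 => if l = i₀ then (0 : AdjoinRoot π) else AdjoinRoot.root π)).F =
        ((⟨MvPowerSeries.map ιΩ F₀, r⟩ : Series (Fin 2) Ω).step p i₀ b).F := by
  classical
  -- a root of `π` in `Ω` and the lift
  have hdeg : (π.map ιΩ).degree ≠ 0 := by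
    rw [Polynomial.degree_map]
    exact fun h => hπ.out.not_isUnit (Polynomial.isUnit_iff_degree_eq_zero.mpr h)
  obtain ⟨θ, hθ⟩ := IsAlgClosed.exists_root (π.map ιΩ) hdeg
  have hev : Polynomial.eval₂ ιΩ θ π = 0 := by rw [Polynomial.eval₂_eq_eval_map]; exact hθ
  set ι₁ : AdjoinRoot π →+* Ω := AdjoinRoot.lift ιΩ θ hev with hι₁
  have hι₁of : ∀ l, ι₁ (AdjoinRoot.of π l) = ιΩ l := fun l => AdjoinRoot.lift_of hev
  have hι₁root : ι₁ (AdjoinRoot.root π) = θ := AdjoinRoot.lift_root hev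
  set bK : Fin 2 → AdjoinRoot π := fun l => if l = i₀ then 0 else AdjoinRoot.root π with hbK
  set b : Fin 2 → Ω := ι₁ ∘ bK with hb
  have hbapp : ∀ l, b l = if l = i₀ then 0 else θ := fun l => by
    rw [hb, Function.comp_apply, hbK]; dsimp only; split_ifs <;> simp [hι₁root]
  have hcomp : ι₁.comp (AdjoinRoot.of π) = ιΩ := RingHom.ext hι₁of
  have hmapmap : MvPowerSeries.map ι₁ (MvPowerSeries.map (AdjoinRoot.of π) F₀) = MvPowerSeries.map ιΩ F₀ := by
    rw [map_map_F, hcomp]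
  refine ⟨ι₁, b, hι₁of, by rw [hbapp, if_pos rfl], fun l hl => by rw [hbapp, if_neg hl, hι₁root], fun l hl => ?_, fun x => ?_, ?_, ?_⟩
  · rw [hbapp, if_neg hl]; exact hθ
  · obtain ⟨P, rfl⟩ := AdjoinRoot.mk_surjective x
    exact ⟨P, by rw [AdjoinRoot.lift_mk, Polynomial.eval₂_eq_eval_map, hι₁root]⟩
  · have h := (Series.isEquimultiplePoint_map_iff ι₁ p i₀ bK (⟨MvPowerSeries.map (AdjoinRoot.of π) F₀, r⟩ : Series (Fin 2) (AdjoinRoot π))).mpr hequi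
    rwa [hmapmap] at h
  · have h := Series.step_map_F ι₁ p i₀ bK (⟨MvPowerSeries.map (AdjoinRoot.of π) F₀, r⟩ : Series (Fin 2) (AdjoinRoot π))
    rw [hmapmap] at h
    exact h.symm

end Omega

/-! ## §2 The formal step at an arbitrary closed point (scheme level) -/

section Scheme

open CategoryTheory AlgebraicGeometry TopologicalSpace
open Literature.AlgebraicGeometry.Hironaka2017.S02Preliminaries
open Literature.AlgebraicGeometry.Hironaka2017.Datum
open Scheme.IdealSheafData

variable {p : ℕ} [hp : Fact p.Prime] {K : Type} [Field K] [CharP K p]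
  {K₀ : Type} [Field K₀] [CharP K₀ p] [PerfectRing K₀ p]
  {Ω : Type} [Field Ω] [IsAlgClosed Ω] [DecidableEq Ω] (ιΩ : K₀ →+* Ω)

/-- [OURS · L1 W4.6 rung (iii-2) — THE FORMAL STEP AT AN ARBITRARY CLOSED POINT for POWER-SERIES residuals; replaces the role of «the
transform `E′` of `E` by the blowup with center `D`» (H. Hironaka, ms. 2017, Def. 2.1 p.5) for a FORMALLY ANCHORED window germ at a point
that need NOT be residually rational; NOT a statement of the manuscript] See the module docstring. Inputs: the blow-up `π` of an ambient datum
along the reduced closed point `ξ = π(ξ′) ∈ Sing(E)`, `E.b = p`, `𝒪_{Z,ξ}` and `𝒪_{Z′,ξ′}` regular of embedding dimension `3`, `ξ′ ∈ Sing(E′)`,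
and a formal anchor `E₀(f₀) = w · (z^p + F(u))` of `J_ξ = (f₀)` over a perfect field `K₀` with `p < ord F` (finite); `ιΩ : K₀ → Ω` into an
algebraically closed field. Output: the anchor upstairs over a perfect field `K₁` with `ι₁ : K₁ → Ω`, and the model step read in `Ω`.
[cite: StacksProject, Tag 0804] [cite: Matsumura1987, Thm. 8.11] -/
theorem exists_formalNRAnchor_step {A A' : AmbientDatum p K} (π : A'.Z ⟶ A.Z) (D : Closeds A.Z) (hπ : IsBlowup π (vanishingIdeal D))
    {E : IdealExponent A.Z} (hb : E.b = p) {ξ' : A'.Z} (hD : (D : Set A.Z) = {π.base ξ'}) (hξ : π.base ξ' ∈ E.sing)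
    (hξ' : ξ' ∈ (E.transform π D).sing) (h3 : (maximalIdeal (A.Z.presheaf.stalk (π.base ξ'))).spanFinrank = 3)
    (hreg' : IsRegularLocalRing (A'.Z.presheaf.stalk ξ')) (h3' : (maximalIdeal (A'.Z.presheaf.stalk ξ')).spanFinrank = 3)
    (E₀ : AdicCompletion (maximalIdeal (A.Z.presheaf.stalk (π.base ξ'))) (A.Z.presheaf.stalk (π.base ξ')) ≃+*
      MvPowerSeries (Option (Fin 2)) K₀)
    {f₀ : A.Z.presheaf.stalk (π.base ξ')} (hJ : stalkIdeal E.J (π.base ξ') = Ideal.span {f₀}) {w : MvPowerSeries (Option (Fin 2)) K₀}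
    (hw : IsUnit w) (F₀ : MvPowerSeries (Fin 2) K₀) (r : Fin 2 →₀ ℕ) {o : ℕ} (ho : F₀.order = o) (hpo : p < o)
    (hE₀ : E₀ (algebraMap _ _ f₀) = w * (MvPowerSeries.X none ^ p + MvPowerSeries.rename (some : Fin 2 → Option (Fin 2)) F₀)) :
    ∃ (K₁ : Type) (_ : Field K₁) (_ : CharP K₁ p) (_ : PerfectField K₁) (ι₁ : K₁ →+* Ω) (c : Fin 2) (b : Fin 2 → Ω)
      (E' : AdicCompletion (maximalIdeal (A'.Z.presheaf.stalk ξ')) (A'.Z.presheaf.stalk ξ') ≃+* MvPowerSeries (Option (Fin 2)) K₁)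
      (f' : A'.Z.presheaf.stalk ξ') (w' : MvPowerSeries (Option (Fin 2)) K₁) (F' : MvPowerSeries (Fin 2) K₁)
      (π₀ : Polynomial K₀) (c' : Fin 2),
      b c = 0 ∧ (c = 1 → ∀ l, b l = 0) ∧ c' ≠ c ∧ Irreducible π₀ ∧ π₀.Monic ∧ (π₀.map ιΩ).eval (b c') = 0 ∧
      (∀ x : K₁, ∃ P : Polynomial K₀, ι₁ x = (P.map ιΩ).eval (b c')) ∧
      (⟨MvPowerSeries.map ιΩ F₀, r⟩ : Series (Fin 2) Ω).IsEquimultiplePoint p c b ∧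
      stalkIdeal (E.transform π D).J ξ' = Ideal.span {f'} ∧ IsUnit w' ∧
      E' (algebraMap _ _ f') = w' * (MvPowerSeries.X none ^ p + MvPowerSeries.rename (some : Fin 2 → Option (Fin 2)) F') ∧
      MvPowerSeries.map ι₁ F' = ((⟨MvPowerSeries.map ιΩ F₀, r⟩ : Series (Fin 2) Ω).step p c b).F := by
  classical
  haveI : IsLocallyNoetherian A'.Z := ambient_isLocallyNoetherian A'
  haveI : IsRegularLocalRing (A.Z.presheaf.stalk (π.base ξ')) := ambient_isRegular A _
  haveI := hreg'
  haveI : PerfectField K₀ := PerfectRing.toPerfectField K₀ p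
  set g := (π.stalkMap ξ').hom with hgdef
  have hloc : IsLocalHom g := inferInstance
  have hg : (maximalIdeal (A.Z.presheaf.stalk (π.base ξ'))).map g ≤ maximalIdeal (A'.Z.presheaf.stalk ξ') :=
    ((IsLocalRing.local_hom_TFAE g).out 0 2).mp hloc
  -- an adapted regular system of parameters at `π ξ′`
  obtain ⟨c, hc, hcX⟩ := exists_rsop_adapted E₀
  have hcl : IsClosed ({π.base ξ'} : Set A.Z) := hD ▸ D.isClosed
  have hcJ : Ideal.span (Set.range c) = stalkIdeal (vanishingIdeal D) (π.base ξ') := by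
    rw [hc, stalkIdeal_vanishingIdeal_eq_maximalIdeal_of_closure_eq]
    rw [hD, hcl.closure_eq]
  have hd' : (maximalIdeal (A.Z.presheaf.stalk (π.base ξ'))).spanFinrank = Fintype.card (Option (Fin 2)) := by rw [h3]; simp
  have hdimL : ringKrullDim (A'.Z.presheaf.stalk ξ') = Fintype.card (Option (Fin 2)) := by
    have h := IsRegularLocalRing.spanFinrank_maximalIdeal (R := A'.Z.presheaf.stalk ξ')
    rw [h3'] at h; rw [← h]; simp
  have hdimL3 : ringKrullDim (A'.Z.presheaf.stalk ξ') = 3 := by rw [hdimL]; simp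
  obtain ⟨i, e, he, hei, hnzd, hNoeth, hcont⟩ := exists_stalk_chartData_nr hπ ξ' c hcJ hc hd' hdimL
  haveI := hNoeth
  -- `f₀ ∈ 𝔪^p` and `f₀ ≡ u c_z^p (mod 𝔪^{p+1})`
  have hf₀𝔪 : f₀ ∈ maximalIdeal (A.Z.presheaf.stalk (π.base ξ')) ^ p := by
    have h := (le_idealOrder_iff E.J _ E.b).mp hξ
    rw [hJ, Ideal.span_singleton_le_iff_mem, hb] at h
    exact h
  have hF₀ord : ((p + 1 : ℕ) : ℕ∞) ≤ F₀.order := by rw [ho]; exact_mod_cast hpo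
  obtain ⟨u, hu, hf₀u⟩ := exists_unit_sub_mul_pow_mem E₀ c hcX f₀ w hw F₀ hF₀ord hE₀
  -- the controlled transform in the chart `c_i` and its singularity
  obtain ⟨f', hf'⟩ := exists_eq_pow_mul_of_mem_pow g c hc i e he hf₀𝔪
  have hJ' : stalkIdeal (E.transform π D).J ξ' = Ideal.span {f'} :=
    stalkIdeal_transform_eq_span hπ ξ' c hcJ i e he hnzd E f₀ hJ f' (by rw [hb]; exact hf')
  have hf'𝔪 : f' ∈ maximalIdeal (A'.Z.presheaf.stalk ξ') ^ p := by
    have h := (mem_sing_transform_iff E ξ' f' hJ').mp hξ'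
    rwa [hb] at h
  have hf'𝔪1 : f' ∈ maximalIdeal (A'.Z.presheaf.stalk ξ') := Ideal.pow_le_self hp.out.ne_zero hf'𝔪
  -- the conclusion from non-rational chart data in a `u`-chart `some j₀` in the Hauser–Wagner frame
  have tail : ∀ (j₀ j₁ : Fin 2) (hj : j₁ ≠ j₀) (htwo : ∀ l, l = j₀ ∨ l = j₁) (e : Option (Fin 2) → A'.Z.presheaf.stalk ξ')
      (πR : Polynomial (A.Z.presheaf.stalk (π.base ξ'))),
      (∀ j, g (c j) = g (c (some j₀)) * e j) → g (c (some j₀)) ∈ nonZeroDivisors (A'.Z.presheaf.stalk ξ') → πR.Monic →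
      Irreducible (πR.map (residue (A.Z.presheaf.stalk (π.base ξ')))) →
      Ideal.span {g (c (some j₀)), e none, (πR.map g).eval (e (some j₁))} = maximalIdeal (A'.Z.presheaf.stalk ξ') →
      (∀ y : A'.Z.presheaf.stalk ξ', ∃ P : Polynomial (A.Z.presheaf.stalk (π.base ξ')), y - (P.map g).eval (e (some j₁)) ∈ maximalIdeal _) →
      (j₀ = 1 → πR.map ((MvPowerSeries.constantCoeff.comp (E₀ : AdicCompletion (maximalIdeal (A.Z.presheaf.stalk (π.base ξ'))) (A.Z.presheaf.stalk (π.base ξ')) →+*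
        MvPowerSeries (Option (Fin 2)) K₀)).comp (algebraMap (A.Z.presheaf.stalk (π.base ξ')) _)) = Polynomial.X) →
      ∃ (K₁ : Type) (_ : Field K₁) (_ : CharP K₁ p) (_ : PerfectField K₁) (ι₁ : K₁ →+* Ω) (c : Fin 2) (b : Fin 2 → Ω)
        (E' : AdicCompletion (maximalIdeal (A'.Z.presheaf.stalk ξ')) (A'.Z.presheaf.stalk ξ') ≃+* MvPowerSeries (Option (Fin 2)) K₁)
        (f' : A'.Z.presheaf.stalk ξ') (w' : MvPowerSeries (Option (Fin 2)) K₁) (F' : MvPowerSeries (Fin 2) K₁)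
        (π₀ : Polynomial K₀) (c' : Fin 2),
        b c = 0 ∧ (c = 1 → ∀ l, b l = 0) ∧ c' ≠ c ∧ Irreducible π₀ ∧ π₀.Monic ∧ (π₀.map ιΩ).eval (b c') = 0 ∧
        (∀ x : K₁, ∃ P : Polynomial K₀, ι₁ x = (P.map ιΩ).eval (b c')) ∧
        (⟨MvPowerSeries.map ιΩ F₀, r⟩ : Series (Fin 2) Ω).IsEquimultiplePoint p c b ∧
        stalkIdeal (E.transform π D).J ξ' = Ideal.span {f'} ∧ IsUnit w' ∧
        E' (algebraMap _ _ f') = w' * (MvPowerSeries.X none ^ p + MvPowerSeries.rename (some : Fin 2 → Option (Fin 2)) F') ∧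
        MvPowerSeries.map ι₁ F' = ((⟨MvPowerSeries.map ιΩ F₀, r⟩ : Series (Fin 2) Ω).step p c b).F := by
    intro j₀ j₁ hj htwo e πR he hnzd hm hirr hgen hres hHW
    set ev₀ := (MvPowerSeries.constantCoeff.comp (E₀ : AdicCompletion (maximalIdeal (A.Z.presheaf.stalk (π.base ξ'))) (A.Z.presheaf.stalk (π.base ξ')) →+*
        MvPowerSeries (Option (Fin 2)) K₀)).comp
      (algebraMap (A.Z.presheaf.stalk (π.base ξ')) (AdicCompletion (maximalIdeal (A.Z.presheaf.stalk (π.base ξ'))) (A.Z.presheaf.stalk (π.base ξ'))))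
      with hev₀
    set π₀ := πR.map ev₀ with hπ₀
    have hirr₀ : Irreducible π₀ := irreducible_map_ev₀ E₀ hirr
    haveI : Fact (Irreducible π₀) := ⟨hirr₀⟩
    have hm₀ : π₀.Monic := hm.map _
    obtain ⟨f'', hf''⟩ := exists_eq_pow_mul_of_mem_pow g c hc (some j₀) e he hf₀𝔪
    have hJ'' : stalkIdeal (E.transform π D).J ξ' = Ideal.span {f''} :=
      stalkIdeal_transform_eq_span hπ ξ' c hcJ (some j₀) e he hnzd E f₀ hJ f'' (by rw [hb]; exact hf'')
    have hf''𝔪 : f'' ∈ maximalIdeal (A'.Z.presheaf.stalk ξ') ^ p := by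
      have h := (mem_sing_transform_iff E ξ' f'' hJ'').mp hξ'
      rwa [hb] at h
    obtain ⟨E', w', hw', -, hHWb, hequi, hE'⟩ := exists_ringEquiv_transform_seriesAnchor_nr g hg E₀ c hc hcX hj htwo e he πR hm π₀ rfl
      hgen hres hdimL3 ⟨F₀, r⟩ ho hpo.le f₀ w hw hE₀ hHW f'' hf'' hf''𝔪
    obtain ⟨ι₁, b, hι₁of, hbj₀, hbj₁, hbroot, hgenK₁, hequiΩ, hstepΩ⟩ := exists_embedding_step ιΩ π₀ j₀ F₀ r hequi
    haveI : Module.Finite K₀ (AdjoinRoot π₀) := (AdjoinRoot.powerBasis hirr₀.ne_zero).finite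
    haveI : PerfectField (AdjoinRoot π₀) := Algebra.IsAlgebraic.perfectField K₀
    haveI : CharP (AdjoinRoot π₀) p := charP_of_injective_ringHom (AdjoinRoot.of π₀).injective p
    refine ⟨AdjoinRoot π₀, inferInstance, inferInstance, inferInstance, ι₁, j₀, b, E', f'', w', _, π₀, j₁, hbj₀, fun h1 l => ?_, hj, hirr₀, hm₀,
      hbroot j₁ hj, fun x => ?_, hequiΩ, hJ'', hw', hE', hstepΩ⟩
    · rcases htwo l with rfl | rfl
      · exact hbj₀
      · have h2 := hHWb h1 l
        simp only [if_neg hj] at h2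
        rw [hbj₁ _ hj, h2, map_zero]
    · obtain ⟨P, hP⟩ := hgenK₁ x
      exact ⟨P, by rw [hP, hbj₁ _ hj]⟩
  -- case analysis on the chart delivered by the Rees-chart presentation
  cases i with
  | none => exact (false_of_zChart_nr c hc g hg e he hnzd hu hf₀u f' hf' hf'𝔪1).elim
  | some i₀ =>
    have hez : e none ∈ maximalIdeal (A'.Z.presheaf.stalk ξ') := e_mem_maximalIdeal_of_transform c hc g hg e he hnzd hu hf₀u f' hf' hf'𝔪1
    obtain ⟨i₁, hi, htwo⟩ := exists_other_index i₀
    have hall : ∀ j : Option (Fin 2), j = some i₀ ∨ j = some i₁ ∨ j = none := by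
      intro j
      cases j with
      | none => exact Or.inr (Or.inr rfl)
      | some l => rcases htwo l with rfl | rfl <;> simp
    obtain ⟨πR, hm, hirr, hgen, hres⟩ := hcont (some i₁) none (fun h => hi (Option.some_injective _ h)) (Option.some_ne_none i₀).symm
      (Option.some_ne_none i₁) hall hez
    by_cases hHW : i₀ = 1 → e (some i₁) ∈ maximalIdeal (A'.Z.presheaf.stalk ξ')
    · by_cases h1 : i₀ = 1
      · -- the origin of the chart `u₁`: `π̃ := X`
        exact tail i₀ i₁ hi htwo e Polynomial.X he hnzd Polynomial.monic_X (by rw [Polynomial.map_X]; exact Polynomial.irreducible_X)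
          (span_origin_of_mem c hc g e he πR hgen (hHW h1)) (by simpa only [Polynomial.map_X, Polynomial.eval_X] using hres)
          (fun _ => by rw [Polynomial.map_X])
      · exact tail i₀ i₁ hi htwo e πR he hnzd hm hirr hgen hres (fun h => absurd h h1)
    · -- a torus point delivered in the chart `u₁`: re-read it in the chart `u₀` (brick 5)
      rw [Classical.not_imp] at hHW
      obtain ⟨h1, hey⟩ := hHW
      have hv : IsUnit (e (some i₁)) := (IsLocalRing.notMem_maximalIdeal).mp hey
      obtain ⟨v', hvv'⟩ := hv.exists_right_inv
      obtain ⟨ρR, hρm, hρirr, hgen', hres'⟩ :=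
        exists_reindex_nr g hg (g (c (some i₀))) (e none) (e (some i₁)) v' hvv' πR hm hirr hgen hres
      set e'' : Option (Fin 2) → A'.Z.presheaf.stalk ξ' := fun j => e j * v' with he''def
      have he'' : ∀ j, g (c j) = g (c (some i₁)) * e'' j := fun j => by
        rw [he''def]; dsimp only
        rw [he (some i₁), he j]
        calc g (c (some i₀)) * e j = g (c (some i₀)) * (e (some i₁) * v') * e j := by rw [hvv', mul_one]
          _ = g (c (some i₀)) * e (some i₁) * (e j * v') := by ring
      have hnzd'' : g (c (some i₁)) ∈ nonZeroDivisors (A'.Z.presheaf.stalk ξ') := by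
        rw [he (some i₁)]; exact mul_mem hnzd hv.mem_nonZeroDivisors
      have he''0 : e'' (some i₀) = v' := by rw [he''def]; dsimp only; rw [hei, one_mul]
      have he''z : e'' none = e none * v' := rfl
      have hgen'' : Ideal.span {g (c (some i₁)), e'' none, (ρR.map g).eval (e'' (some i₀))} = maximalIdeal (A'.Z.presheaf.stalk ξ') := by
        rw [he''0, he''z, he (some i₁)]; exact hgen'
      have hres'' : ∀ y : A'.Z.presheaf.stalk ξ', ∃ Q : Polynomial (A.Z.presheaf.stalk (π.base ξ')),
          y - (Q.map g).eval (e'' (some i₀)) ∈ maximalIdeal _ := fun y => by rw [he''0]; exact hres' y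
      have htwo' : ∀ l, l = i₁ ∨ l = i₀ := fun l => (htwo l).symm
      have hi₁ : i₁ ≠ 1 := fun h => hi (h.trans h1.symm)
      exact tail i₁ i₀ (Ne.symm hi) htwo' e'' ρR he'' hnzd'' hρm hρirr hgen'' hres'' (fun h => absurd h hi₁)

end Scheme

end MohWindowShadeFormalNR

end CampaignW46

end Summit.ResolutionOfSingularities.ResolutionOfSingularities.Theorems

end
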